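import Mathlib.NumberTheory.LocalField.Basic
import Mathlib.RingTheory.Henselian
import Mathlib.FieldTheory.Finite.Basic
import Mathlib.GroupTheory.OrderOfElement
import Mathlib.Algebra.Ring.GeomSum
import Mathlib.NumberTheory.LSeries.PrimesInAP
import Literature.AnabelianGeometry.AbsoluteAnabelian.MLFUnitsInfinitelyDivisible
import HarnessLib

/-!
# Units of a non-archimedean local field: `u ↦ u^ℓ` is a bijection of `𝒪_K^×` for every prime
# `ℓ` exceeding the cardinality of the residue field

Classical local algebra (J. Neukirch, *Algebraic Number Theory*, Ch. II, Prop. (5.3):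
`U_K = μ_{q−1} × U_K^{(1)}`, and Prop. (5.7) (i): for `(m, p) = 1` the map `x ↦ x^m` is an
automorphism of `U_K^{(n)}`, `n ≥ 1`) [cite: NeukirchANT1999, Ch. II Prop. 5.7]: for a
non-archimedean local field `K` with residue field `𝓀` of cardinality `q` and a prime `ℓ > q` (so
`ℓ ≠ p` and `gcd(ℓ, q − 1) = 1`), the `ℓ`-th power map of `𝒪_K^×` is BIJECTIVE:

* `isUnit_exists_pow_eq_of_card_lt` — surjectivity: every unit is an `ℓ`-th power of a unit (the
  Hensel argument of the tree's `IsNonarchimedeanLocalField.exists_prime_forall_isUnit_exists_pow_eq`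
  (`MLFUnitsInfinitelyDivisible.lean`, stated there for SOME prime), here for EVERY prime `ℓ > q`:
  `z ↦ z^ℓ` is a bijection of `𝓀^×`, so `Y^ℓ − u` has a simple root mod `𝓂`, lifted by
  `HenselianRing.is_henselian`, `𝒪_K` being `𝓂`-adically complete);
* `units_eq_one_of_pow_eq_one_of_card_lt` — injectivity: `𝒪_K^×` has no `ℓ`-torsion (a unit `u`
  with `u^ℓ = 1` reduces to `1` in `𝓀^×` by the same bijection, and then
  `(∑_{i<ℓ} u^i)·(u − 1) = u^ℓ − 1 = 0` with `∑_{i<ℓ} u^i ≡ ℓ` a unit forces `u = 1`);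
* `pow_units_bijective_of_card_lt` — the bijection; and, by Dirichlet's theorem on primes in
  arithmetic progressions (Mathlib `Nat.forall_exists_prime_gt_and_eq_mod`), for every `N ≥ 1` and
  unit residue class `a mod N` such a prime exists in the class `a`
  (`exists_prime_pow_units_bijective_and_natCast_eq`).

Written for the abc-iut cell (seat abc-iut-w5-d248) as the arithmetic input of [FrdII] Remark 2.4.2
(the unit-wise Frobenius witness); nothing here concerns [IUTchIII]. Mathlib + one tree lemma only.
-/

namespace Literature.NumberTheory.LocalFields

open ValuativeRel Polynomial Finset

variable {K : Type*} [Field K] [ValuativeRel K] [TopologicalSpace K] [IsNonarchimedeanLocalField K]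

/-- A prime exceeding the cardinality of the (finite) residue field is non-zero in it.
[cite: NeukirchANT1999, Ch. II Prop. 5.7] -/
theorem natCast_residueField_ne_zero_of_card_lt {ℓ : ℕ} (hℓ : ℓ.Prime) (hq : Nat.card 𝓀[K] < ℓ) :
    (ℓ : 𝓀[K]) ≠ 0 := by
  classical
  haveI : Fintype 𝓀[K] := Fintype.ofFinite _
  intro h
  have h1 : ringChar 𝓀[K] = ℓ := CharP.ringChar_of_prime_eq_zero hℓ h
  have h2 : ringChar 𝓀[K] ∣ Fintype.card 𝓀[K] :=
    ringChar.dvd (FiniteField.cast_card_eq_zero 𝓀[K])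
  rw [h1] at h2
  have h3 := Nat.le_of_dvd Fintype.card_pos h2
  rw [← Nat.card_eq_fintype_card] at h3
  omega

/-- For a prime `ℓ > #𝓀`, the order of `𝓀^×` is prime to `ℓ` (so `z ↦ z^ℓ` is a bijection of `𝓀^×`,
Mathlib `powCoprime`). [cite: NeukirchANT1999, Ch. II Prop. 5.7] -/
theorem card_units_residueField_coprime_of_card_lt {ℓ : ℕ} (hℓ : ℓ.Prime)
    (hq : Nat.card 𝓀[K] < ℓ) : (Nat.card 𝓀[K]ˣ).Coprime ℓ := by
  have hle : Nat.card 𝓀[K]ˣ ≤ Nat.card 𝓀[K] :=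
    Nat.card_le_card_of_injective (fun z : 𝓀[K]ˣ => (z : 𝓀[K])) Units.val_injective
  have hpos : Nat.card 𝓀[K]ˣ ≠ 0 := Nat.card_pos.ne'
  exact (Nat.coprime_of_lt_prime hpos (by omega) hℓ).symm

/-- **Surjectivity**: for a prime `ℓ > #𝓀`, every unit of `𝒪_K` is the `ℓ`-th power of a unit
(Hensel's lemma applied to `Y^ℓ − u`). [cite: NeukirchANT1999, Ch. II Prop. 5.7] -/
theorem isUnit_exists_pow_eq_of_card_lt {ℓ : ℕ} (hℓ : ℓ.Prime) (hq : Nat.card 𝓀[K] < ℓ)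
    (u : 𝒪[K]) (hu : IsUnit u) : ∃ y : 𝒪[K], IsUnit y ∧ y ^ ℓ = u := by
  classical
  haveI : HenselianRing 𝒪[K] 𝓂[K] :=
    Literature.AnabelianGeometry.AbsoluteAnabelian.IsNonarchimedeanLocalField.henselianRing_integer K
  have hℓ0 : ℓ ≠ 0 := hℓ.ne_zero
  have hℓk : (ℓ : 𝓀[K]) ≠ 0 := natCast_residueField_ne_zero_of_card_lt hℓ hq
  have hcop : (Nat.card 𝓀[K]ˣ).Coprime ℓ := card_units_residueField_coprime_of_card_lt hℓ hq
  have hu' : IsUnit (IsLocalRing.residue 𝒪[K] u) := hu.map _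
  obtain ⟨zbar, hz⟩ := (powCoprime hcop).surjective hu'.unit
  rw [powCoprime_apply] at hz
  obtain ⟨a₀, ha₀⟩ := IsLocalRing.residue_surjective (R := 𝒪[K]) (zbar : 𝓀[K])
  -- Hensel's lemma for `Y ^ ℓ - u` at `a₀`
  have hmonic : (X ^ ℓ - C u : 𝒪[K][X]).Monic := monic_X_pow_sub_C u hℓ0
  have h₁ : (X ^ ℓ - C u : 𝒪[K][X]).eval a₀ ∈ 𝓂[K] := by
    rw [← IsLocalRing.residue_eq_zero_iff]
    simp only [eval_sub, eval_pow, eval_X, eval_C, map_sub, map_pow, ha₀]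
    rw [← Units.val_pow_eq_pow_val, hz, IsUnit.unit_spec, sub_self]
  have h₂ : IsUnit (Ideal.Quotient.mk 𝓂[K] ((X ^ ℓ - C u : 𝒪[K][X]).derivative.eval a₀)) := by
    change IsUnit (IsLocalRing.residue 𝒪[K] ((X ^ ℓ - C u : 𝒪[K][X]).derivative.eval a₀))
    rw [isUnit_iff_ne_zero]
    simp only [derivative_sub, derivative_X_pow, derivative_C, sub_zero, eval_mul, eval_natCast,
      eval_pow, eval_X, map_mul, map_natCast, map_pow, ha₀]
    exact mul_ne_zero hℓk (pow_ne_zero _ zbar.ne_zero)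
  obtain ⟨a, hroot, -⟩ := HenselianRing.is_henselian (X ^ ℓ - C u) hmonic a₀ h₁ h₂
  have ha : a ^ ℓ = u := by
    have : (X ^ ℓ - C u : 𝒪[K][X]).eval a = 0 := hroot
    simpa [sub_eq_zero] using this
  exact ⟨a, (isUnit_pow_iff hℓ0).mp (ha ▸ hu), ha⟩

/-- **Injectivity**: for a prime `ℓ > #𝓀`, `𝒪_K^×` has no non-trivial `ℓ`-torsion.
[cite: NeukirchANT1999, Ch. II Prop. 5.7] -/
theorem units_eq_one_of_pow_eq_one_of_card_lt {ℓ : ℕ} (hℓ : ℓ.Prime) (hq : Nat.card 𝓀[K] < ℓ)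
    (u : 𝒪[K]ˣ) (h : u ^ ℓ = 1) : u = 1 := by
  classical
  have hℓk : (ℓ : 𝓀[K]) ≠ 0 := natCast_residueField_ne_zero_of_card_lt hℓ hq
  have hcop : (Nat.card 𝓀[K]ˣ).Coprime ℓ := card_units_residueField_coprime_of_card_lt hℓ hq
  -- the residue of `u` is `1`
  have hubar : Units.map (IsLocalRing.residue 𝒪[K] : 𝒪[K] →* 𝓀[K]) u = 1 := by
    apply (powCoprime hcop).injective
    rw [powCoprime_apply, powCoprime_apply, one_pow, ← map_pow, h, map_one]
  have hres : IsLocalRing.residue 𝒪[K] (u : 𝒪[K]) = 1 := by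
    have := congrArg (fun z : 𝓀[K]ˣ => (z : 𝓀[K])) hubar
    simpa using this
  -- `∑_{i<ℓ} u^i` is a unit: its residue is `ℓ ≠ 0`
  have hsum : IsUnit (∑ i ∈ range ℓ, (u : 𝒪[K]) ^ i) := by
    rw [← IsLocalRing.residue_ne_zero_iff_isUnit, map_sum]
    simp_rw [map_pow, hres, one_pow]
    rw [sum_const, card_range, nsmul_eq_mul, mul_one]
    exact hℓk
  -- `(∑ u^i) · (u - 1) = u^ℓ - 1 = 0`
  have hgeom : (∑ i ∈ range ℓ, (u : 𝒪[K]) ^ i) * ((u : 𝒪[K]) - 1) = 0 := by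
    rw [geom_sum_mul, ← Units.val_pow_eq_pow_val, h, Units.val_one, sub_self]
  have hu1 : (u : 𝒪[K]) - 1 = 0 := hsum.mul_right_eq_zero.mp hgeom
  exact Units.ext (sub_eq_zero.mp hu1)

/-- **`u ↦ u^ℓ` is a bijection of `𝒪_K^×`** for every prime `ℓ` exceeding the cardinality of the
residue field. [cite: NeukirchANT1999, Ch. II Prop. 5.7] -/
theorem pow_units_bijective_of_card_lt {ℓ : ℕ} (hℓ : ℓ.Prime) (hq : Nat.card 𝓀[K] < ℓ) :
    Function.Bijective fun u : 𝒪[K]ˣ => u ^ ℓ := by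
  refine ⟨fun u v huv => ?_, fun w => ?_⟩
  · have huv' : u ^ ℓ = v ^ ℓ := huv
    have h1 : (u * v⁻¹) ^ ℓ = 1 := by rw [mul_pow, huv', inv_pow, mul_inv_cancel]
    exact mul_inv_eq_one.mp (units_eq_one_of_pow_eq_one_of_card_lt hℓ hq _ h1)
  · obtain ⟨y, hy, hyw⟩ := isUnit_exists_pow_eq_of_card_lt hℓ hq (w : 𝒪[K]) w.isUnit
    exact ⟨hy.unit, Units.ext (by rw [Units.val_pow_eq_pow_val, IsUnit.unit_spec, hyw])⟩

/-- Element form of injectivity: two units of `𝒪_K` with the same `ℓ`-th power are equal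
(`ℓ` prime, `ℓ > #𝓀`). [cite: NeukirchANT1999, Ch. II Prop. 5.7] -/
theorem eq_of_isUnit_of_pow_eq_of_card_lt {ℓ : ℕ} (hℓ : ℓ.Prime) (hq : Nat.card 𝓀[K] < ℓ)
    {x y : 𝒪[K]} (hx : IsUnit x) (hy : IsUnit y) (h : x ^ ℓ = y ^ ℓ) : x = y := by
  have h1 : hx.unit ^ ℓ = hy.unit ^ ℓ :=
    Units.ext (by rw [Units.val_pow_eq_pow_val, Units.val_pow_eq_pow_val, IsUnit.unit_spec,
      IsUnit.unit_spec, h])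
  have h2 := (pow_units_bijective_of_card_lt hℓ hq).1 h1
  rw [← hx.unit_spec, ← hy.unit_spec, h2]

/-- By Dirichlet's theorem on primes in arithmetic progressions: for `N ≥ 1` and a unit residue
class `a mod N` there is a prime `ℓ > #𝓀` with `ℓ ≡ a (mod N)`; for it `u ↦ u^ℓ` is a bijection of
`𝒪_K^×`. [cite: NeukirchANT1999, Ch. II Prop. 5.7] -/
theorem exists_prime_pow_units_bijective_and_natCast_eq (N : ℕ) [NeZero N] {a : ZMod N}
    (ha : IsUnit a) :
    ∃ ℓ : ℕ, ℓ.Prime ∧ Nat.card 𝓀[K] < ℓ ∧ Function.Bijective (fun u : 𝒪[K]ˣ => u ^ ℓ) ∧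
      (ℓ : ZMod N) = a := by
  obtain ⟨ℓ, hgt, hℓ, hℓa⟩ := Nat.forall_exists_prime_gt_and_eq_mod ha (Nat.card 𝓀[K])
  exact ⟨ℓ, hℓ, hgt, pow_units_bijective_of_card_lt hℓ hgt, hℓa⟩

end Literature.NumberTheory.LocalFields
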